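import Summits.CriticalPhenomena.CardyFormulaZ2.Theorems.CardyIKTransportCornerLineDescentFreezeIdentification

/-!
# The frozen end `p = 0` of the corner line, part 2: flips and runs of a bit sequence (renewal-grid bookkeeping)

Support file (Freeze groundwork, part 2 of 4) for the line `symmetric-seed-second-order` of the crux
`CardyIKTransport.CornerLineDescent` (stmt-CriticalPhenomena-10964), serving the registered stub
`stub_FreezeHomogenisation`.  Deterministic combinatorics of ONE bit sequence `A : Set ℤ` (a column or row factor of
the frozen gauge): `k` is a flip if the bits at `k-1`, `k` differ (`Freeze.IsFlip`, a predicate); a two-sided strictly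
increasing enumeration of the flips (`Freeze.FlipEnum A`: `pos`, the run index `runIdx k` = the `i` with
`pos i ≤ k < pos (i+1)`, bits constant on runs, consecutive runs alternate, parity `pos i ∈ A ↔ (pos 0 ∈ A ↔ Even i)`),
and its EXISTENCE from flips unbounded above and below (`FlipEnum.ofUnbounded`, normalised `pos 0 ≤ 0 < pos 1`) —
the hypothesis that holds a.s. for i.i.d. fair bits.  The anchor `exists_floor_of_strictMono` (a strictly increasing
`ℤ → ℤ` brackets every integer) is the bracketing step of both `runIdx` and `ofUnbounded`.  Part 3 builds the blocks
of the product grid of two such sequences, part 4 the identification of frozen-gauge connectivity with bond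
percolation on the black blocks.  References: route file `Theses/CardyIKTransport.lean` (items 10964, 4967
`RenewalGridHarmless`); Grimmett, *Percolation* (1999) §1.3 (the renewal structure of i.i.d. bits is folklore).
-/

noncomputable section

namespace Summit.CriticalPhenomena.CardyFormulaZ2.Theorems.CornerLineDescent.SymmetricSeed

open scoped BigOperators Topology Classical MeasureTheory ProbabilityTheory ENNReal NNReal
open Filter Set Function MeasureTheory
open Literature.Probability.Percolation (sitePercolation bondPercolation half BondConfig embDomainCrossing rectangle)
open Literature.Probability.LatticeModels
open Literature.Probability.RandomPlanarGeometry


/-- ANCHOR OF PART 2 (registered sub-goal). A strictly increasing `f : ℤ → ℤ` brackets every integer: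
`f i ≤ k < f (i + 1)` for some `i` (gaps of an integer-valued strictly monotone map are `≥ 1`, so `f` is unbounded
above and below; take `i = sup {i | f i ≤ k}`). [folklore] -/
theorem exists_floor_of_strictMono : ∀ (f : ℤ → ℤ), StrictMono f → ∀ (k : ℤ), ∃ i : ℤ, f i ≤ k ∧ k < f (i + 1) := by
  intro f hf k
  have hstep : ∀ n : ℕ, f 0 + n ≤ f n := by
    intro n
    induction n with
    | zero => simp
    | succ n ih => have := hf (show (n : ℤ) < n + 1 by omega); push_cast; omega
  have hdown : ∀ n : ℕ, f (-(n : ℤ)) + n ≤ f 0 := by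
    intro n
    induction n with
    | zero => simp
    | succ n ih => have := hf (show (-(n + 1 : ℕ) : ℤ) < -(n : ℕ) by omega); push_cast at this ⊢; omega
  set S : Set ℤ := {i | f i ≤ k} with hS
  have hne : S.Nonempty := by
    refine ⟨-(((f 0 - k).toNat : ℕ) : ℤ), ?_⟩
    have h1 := hdown (f 0 - k).toNat
    have h2 : f 0 - k ≤ ((f 0 - k).toNat : ℤ) := Int.self_le_toNat _
    show f _ ≤ k
    omega
  have hbdd : BddAbove S := by
    refine ⟨(k - f 0).toNat, fun i (hi : f i ≤ k) => ?_⟩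
    by_contra hlt
    push Not at hlt
    have h2 := hstep i.toNat
    have h3 : (i.toNat : ℤ) = i := Int.toNat_of_nonneg (by omega)
    rw [h3] at h2
    have h4 : k - f 0 ≤ ((k - f 0).toNat : ℤ) := Int.self_le_toNat _
    omega
  refine ⟨sSup S, Int.csSup_mem hne hbdd, ?_⟩
  by_contra hle
  push Not at hle
  have := le_csSup hbdd (show sSup S + 1 ∈ S from hle)
  omega

namespace Freeze

/-- `k` is a FLIP of the bit sequence `A : Set ℤ` if the bits at `k - 1` and `k` differ (a line of the renewal grid
at coordinate `k`, between the cells `k - 1` and `k`). [folklore] -/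
def IsFlip (A : Set ℤ) (k : ℤ) : Prop := ¬ (k - 1 ∈ A ↔ k ∈ A)

/-- A two-sided, strictly increasing ENUMERATION OF THE FLIPS of `A` (`pos i` = the `i`-th grid line).  Such an
enumeration exists iff `A` has infinitely many flips in both directions (a.s. for i.i.d. fair bits). [folklore] -/
structure FlipEnum (A : Set ℤ) where
  /-- position of the `i`-th flip -/
  pos : ℤ → ℤ
  /-- the enumeration is strictly increasing -/
  strictMono : StrictMono pos
  /-- it enumerates exactly the flips -/
  isFlip_iff : ∀ k, IsFlip A k ↔ k ∈ Set.range pos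

namespace FlipEnum

variable {A : Set ℤ} (e : FlipEnum A)

/-- Gaps are at least one: `pos i + n ≤ pos (i + n)`. [folklore] -/
theorem pos_add_le (i : ℤ) (n : ℕ) : e.pos i + n ≤ e.pos (i + n) := by
  induction n with
  | zero => simp
  | succ n ih =>
    have h : e.pos (i + n) < e.pos (i + n + 1) := e.strictMono (by omega)
    have h' : e.pos (i + (n + 1 : ℕ)) = e.pos (i + n + 1) := by push_cast; ring_nf
    rw [h']; push_cast; omega

/-- `pos (i - n) + n ≤ pos i`. [folklore] -/
theorem pos_sub_add_le (i : ℤ) (n : ℕ) : e.pos (i - n) + n ≤ e.pos i := by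
  have := e.pos_add_le (i - n) n
  rwa [sub_add_cancel] at this

/-- The set of run indices below the cell `k` is nonempty … [folklore] -/
theorem nonempty_le (k : ℤ) : {i | e.pos i ≤ k}.Nonempty := by
  refine ⟨0 - ((e.pos 0 - k).toNat : ℕ), ?_⟩
  have h := e.pos_sub_add_le 0 (e.pos 0 - k).toNat
  have h' : e.pos 0 - k ≤ ((e.pos 0 - k).toNat : ℤ) := Int.self_le_toNat _
  show e.pos (0 - ((e.pos 0 - k).toNat : ℕ)) ≤ k
  omega

/-- … and bounded above. [folklore] -/
theorem bddAbove_le (k : ℤ) : BddAbove {i | e.pos i ≤ k} := by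
  refine ⟨(k - e.pos 0).toNat, fun i (hi : e.pos i ≤ k) => ?_⟩
  by_contra hlt
  push Not at hlt
  have h1 : (0 : ℤ) ≤ (k - e.pos 0).toNat := Int.natCast_nonneg _
  have h2 := e.pos_add_le 0 (i.toNat)
  have h3 : (i.toNat : ℤ) = i := Int.toNat_of_nonneg (by omega)
  rw [h3, zero_add] at h2
  have h4 : k - e.pos 0 ≤ ((k - e.pos 0).toNat : ℤ) := Int.self_le_toNat _
  omega

/-- The RUN INDEX of the cell `k`: the `i` with `pos i ≤ k < pos (i + 1)`. [folklore] -/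
def runIdx (k : ℤ) : ℤ := sSup {i | e.pos i ≤ k}

/-- `pos (runIdx k) ≤ k`. [folklore] -/
theorem pos_runIdx_le (k : ℤ) : e.pos (e.runIdx k) ≤ k :=
  Int.csSup_mem (e.nonempty_le k) (e.bddAbove_le k)

/-- `k < pos (runIdx k + 1)`. [folklore] -/
theorem lt_pos_runIdx_add_one (k : ℤ) : k < e.pos (e.runIdx k + 1) := by
  by_contra h
  push Not at h
  have := le_csSup (e.bddAbove_le k) (show e.runIdx k + 1 ∈ {i | e.pos i ≤ k} from h)
  simp [runIdx] at this

/-- Characterisation of the run index. [folklore] -/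
theorem runIdx_eq_iff {k i : ℤ} : e.runIdx k = i ↔ e.pos i ≤ k ∧ k < e.pos (i + 1) := by
  constructor
  · rintro rfl; exact ⟨e.pos_runIdx_le k, e.lt_pos_runIdx_add_one k⟩
  · rintro ⟨h1, h2⟩
    have h3 := e.pos_runIdx_le k
    have h4 := e.lt_pos_runIdx_add_one k
    have h5 : e.runIdx k < i + 1 := e.strictMono.lt_iff_lt.1 (lt_of_le_of_lt h3 h2)
    have h6 : i < e.runIdx k + 1 := e.strictMono.lt_iff_lt.1 (lt_of_le_of_lt h1 h4)
    omega

/-- The run index of a grid line is its own index. [folklore] -/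
theorem runIdx_pos (i : ℤ) : e.runIdx (e.pos i) = i :=
  e.runIdx_eq_iff.2 ⟨le_rfl, e.strictMono (lt_add_one i)⟩

/-- No flip strictly inside a run. [folklore] -/
theorem not_isFlip_of_lt_of_lt {k i : ℤ} (h1 : e.pos i < k) (h2 : k < e.pos (i + 1)) : ¬ IsFlip A k := by
  rw [e.isFlip_iff]
  rintro ⟨i', rfl⟩
  have h3 : i < i' := e.strictMono.lt_iff_lt.1 h1
  have h4 : i' < i + 1 := e.strictMono.lt_iff_lt.1 h2
  omega

/-- BITS ARE CONSTANT ON RUNS: the bit at `k` is the bit at the left end of its run. [folklore] -/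
theorem mem_iff_pos_runIdx_mem (k : ℤ) : (k ∈ A ↔ e.pos (e.runIdx k) ∈ A) := by
  have key : ∀ (n : ℕ) (i : ℤ), e.pos i + n < e.pos (i + 1) → (e.pos i + n ∈ A ↔ e.pos i ∈ A) := by
    intro n
    induction n with
    | zero => simp
    | succ n ih =>
      intro i hn
      have h1 : e.pos i + n < e.pos (i + 1) := by push_cast at hn; omega
      have hnf := e.not_isFlip_of_lt_of_lt (k := e.pos i + n + 1) (i := i) (by omega) (by push_cast at hn; omega)
      rw [IsFlip, not_not, add_sub_cancel_right] at hnf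
      push_cast
      rw [← add_assoc, ← hnf, ih i h1]
  have h1 := e.pos_runIdx_le k
  have h2 := e.lt_pos_runIdx_add_one k
  have h3 : k = e.pos (e.runIdx k) + ((k - e.pos (e.runIdx k)).toNat : ℕ) := by
    rw [Int.toNat_of_nonneg (by omega)]; ring
  conv_lhs => rw [h3]
  exact key _ _ (by rw [← h3]; exact h2)

/-- CONSECUTIVE RUNS ALTERNATE. [folklore] -/
theorem pos_add_one_mem_iff (i : ℤ) : (e.pos (i + 1) ∈ A ↔ e.pos i ∉ A) := by
  have hf : IsFlip A (e.pos (i + 1)) := (e.isFlip_iff _).2 ⟨i + 1, rfl⟩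
  have hr : e.runIdx (e.pos (i + 1) - 1) = i :=
    e.runIdx_eq_iff.2 ⟨by have := e.strictMono (lt_add_one i); omega, by omega⟩
  have hc := e.mem_iff_pos_runIdx_mem (e.pos (i + 1) - 1)
  rw [hr] at hc
  rw [IsFlip, hc] at hf
  tauto

/-- PARITY OF RUNS: the bit of run `i` is the bit of run `0` iff `i` is even. [folklore] -/
theorem pos_mem_iff_even (i : ℤ) : (e.pos i ∈ A ↔ (e.pos 0 ∈ A ↔ Even i)) := by
  induction i using Int.induction_on with
  | zero => simp
  | succ i ih =>
    rw [e.pos_add_one_mem_iff, ih, Int.even_add_one]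
    tauto
  | pred i ih =>
    have h := e.pos_add_one_mem_iff (-(i : ℤ) - 1)
    rw [sub_add_cancel, ih] at h
    have he : Even (-(i : ℤ) - 1) ↔ ¬ Even (-(i : ℤ)) := Int.even_sub_one
    rw [he]
    tauto

/-- The bit at any cell, from its run index: `k ∈ A ↔ (pos 0 ∈ A ↔ Even (runIdx k))`. [folklore] -/
theorem mem_iff_even_runIdx (k : ℤ) : (k ∈ A ↔ (e.pos 0 ∈ A ↔ Even (e.runIdx k))) := by
  rw [e.mem_iff_pos_runIdx_mem k, e.pos_mem_iff_even]

/-- Adjacent cells with equal bits lie in the same run. [folklore] -/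
theorem runIdx_add_one_of_iff {k : ℤ} (h : k ∈ A ↔ k + 1 ∈ A) : e.runIdx (k + 1) = e.runIdx k := by
  have h1 := e.pos_runIdx_le k
  have h2 := e.lt_pos_runIdx_add_one k
  refine e.runIdx_eq_iff.2 ⟨by omega, lt_of_le_of_ne (by omega) fun h3 => ?_⟩
  have hf : IsFlip A (k + 1) := (e.isFlip_iff _).2 ⟨_, h3.symm⟩
  rw [IsFlip, add_sub_cancel_right] at hf
  exact hf h

/-- Adjacent cells with different bits lie in consecutive runs, the second starting at the second cell. [folklore] -/
theorem runIdx_add_one_of_not_iff {k : ℤ} (h : ¬ (k ∈ A ↔ k + 1 ∈ A)) :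
    e.runIdx (k + 1) = e.runIdx k + 1 ∧ e.pos (e.runIdx k + 1) = k + 1 := by
  have hf : IsFlip A (k + 1) := by rwa [IsFlip, add_sub_cancel_right]
  obtain ⟨i, hi⟩ := (e.isFlip_iff _).1 hf
  have h1 : e.runIdx (k + 1) = i := by rw [← hi]; exact e.runIdx_pos i
  have h2 : e.runIdx k = i - 1 :=
    e.runIdx_eq_iff.2 ⟨by have := e.strictMono (show i - 1 < i by omega); omega, by rw [sub_add_cancel]; omega⟩
  refine ⟨by omega, ?_⟩
  rw [h2, sub_add_cancel, hi]

end FlipEnum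

namespace FlipEnum

variable {A : Set ℤ}

/-- The least flip above `k` (flips unbounded above). [folklore] -/
theorem exists_next (hup : ∀ N : ℤ, ∃ k, N < k ∧ IsFlip A k) (k : ℤ) :
    ∃ l, (k < l ∧ IsFlip A l) ∧ ∀ z, (k < z ∧ IsFlip A z) → l ≤ z :=
  Int.exists_least_of_bdd ⟨k, fun _ hz => hz.1.le⟩ (hup k)

/-- The greatest flip below `k` (flips unbounded below). [folklore] -/
theorem exists_prev (hdn : ∀ N : ℤ, ∃ k, k < N ∧ IsFlip A k) (k : ℤ) :
    ∃ l, (l < k ∧ IsFlip A l) ∧ ∀ z, (z < k ∧ IsFlip A z) → z ≤ l :=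
  Int.exists_greatest_of_bdd ⟨k, fun _ hz => hz.1.le⟩ (hdn k)

/-- The next flip after `k`. [folklore] -/
noncomputable def next (hup : ∀ N : ℤ, ∃ k, N < k ∧ IsFlip A k) (k : ℤ) : ℤ :=
  Classical.choose (exists_next hup k)

/-- Specification of `next`. [folklore] -/
theorem next_spec (hup : ∀ N : ℤ, ∃ k, N < k ∧ IsFlip A k) (k : ℤ) :
    (k < next hup k ∧ IsFlip A (next hup k)) ∧ ∀ z, (k < z ∧ IsFlip A z) → next hup k ≤ z :=
  Classical.choose_spec (exists_next hup k)

/-- The previous flip before `k`. [folklore] -/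
noncomputable def prev (hdn : ∀ N : ℤ, ∃ k, k < N ∧ IsFlip A k) (k : ℤ) : ℤ :=
  Classical.choose (exists_prev hdn k)

/-- Specification of `prev`. [folklore] -/
theorem prev_spec (hdn : ∀ N : ℤ, ∃ k, k < N ∧ IsFlip A k) (k : ℤ) :
    (prev hdn k < k ∧ IsFlip A (prev hdn k)) ∧ ∀ z, (z < k ∧ IsFlip A z) → z ≤ prev hdn k :=
  Classical.choose_spec (exists_prev hdn k)

section Construction

variable (hup : ∀ N : ℤ, ∃ k, N < k ∧ IsFlip A k) (hdn : ∀ N : ℤ, ∃ k, k < N ∧ IsFlip A k)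

/-- Forward orbit of `next` from the greatest flip `≤ 0`. [folklore] -/
noncomputable def fwd : ℕ → ℤ
  | 0 => prev hdn 1
  | n + 1 => next hup (fwd n)

/-- Backward orbit of `prev` from the greatest flip `≤ 0`. [folklore] -/
noncomputable def bwd : ℕ → ℤ
  | 0 => prev hdn 1
  | n + 1 => prev hdn (bwd n)

/-- The two-sided enumeration glued from `fwd` and `bwd`. [folklore] -/
noncomputable def enum (i : ℤ) : ℤ := if 0 ≤ i then fwd hup hdn i.toNat else bwd hdn (-i).toNat

/-- `enum` on `0 ≤ i` is the forward orbit. [folklore] -/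
theorem enum_of_nonneg {i : ℤ} (hi : 0 ≤ i) : enum hup hdn i = fwd hup hdn i.toNat := if_pos hi

/-- `enum` on `i ≤ 0` is the backward orbit (the two orbits agree at `0`). [folklore] -/
theorem enum_of_nonpos {i : ℤ} (hi : i ≤ 0) : enum hup hdn i = bwd hdn (-i).toNat := by
  rcases hi.lt_or_eq with hi | rfl
  · exact if_neg (not_le.2 hi)
  · simp [enum, fwd, bwd]

/-- Going up: `enum (i + 1) = next (enum i)` for `0 ≤ i`. [folklore] -/
theorem enum_succ {i : ℤ} (hi : 0 ≤ i) : enum hup hdn (i + 1) = next hup (enum hup hdn i) := by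
  rw [enum_of_nonneg hup hdn hi, enum_of_nonneg hup hdn (by omega), show (i + 1).toNat = i.toNat + 1 by omega, fwd]

/-- Going down: `enum i = prev (enum (i + 1))` for `i < 0`. [folklore] -/
theorem enum_pred {i : ℤ} (hi : i < 0) : enum hup hdn i = prev hdn (enum hup hdn (i + 1)) := by
  rw [enum_of_nonpos hup hdn hi.le, enum_of_nonpos hup hdn (by omega), show (-i).toNat = (-(i + 1)).toNat + 1 by omega,
    bwd]

/-- `enum` increases at each step. [folklore] -/
theorem enum_lt_succ (i : ℤ) : enum hup hdn i < enum hup hdn (i + 1) := by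
  rcases le_or_gt 0 i with hi | hi
  · rw [enum_succ hup hdn hi]; exact (next_spec hup _).1.1
  · rw [enum_pred hup hdn hi]; exact (prev_spec hdn _).1.1

/-- Every `fwd n` is a flip. [folklore] -/
theorem isFlip_fwd (n : ℕ) : IsFlip A (fwd hup hdn n) := by
  cases n with
  | zero => exact (prev_spec hdn 1).1.2
  | succ n => exact (next_spec hup _).1.2

/-- Every `bwd n` is a flip. [folklore] -/
theorem isFlip_bwd (n : ℕ) : IsFlip A (bwd hdn n) := by
  cases n with
  | zero => exact (prev_spec hdn 1).1.2
  | succ n => exact (prev_spec hdn _).1.2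

/-- Every `enum i` is a flip. [folklore] -/
theorem isFlip_enum (i : ℤ) : IsFlip A (enum hup hdn i) := by
  unfold enum; split_ifs
  · exact isFlip_fwd hup hdn _
  · exact isFlip_bwd hdn _

/-- No flip strictly between consecutive values of `enum`. [folklore] -/
theorem not_isFlip_between (i : ℤ) {z : ℤ} (h1 : enum hup hdn i < z) (h2 : z < enum hup hdn (i + 1)) :
    ¬ IsFlip A z := by
  intro hz
  rcases le_or_gt 0 i with hi | hi
  · rw [enum_succ hup hdn hi] at h2
    have := (next_spec hup (enum hup hdn i)).2 z ⟨h1, hz⟩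
    omega
  · rw [enum_pred hup hdn hi] at h1
    have := (prev_spec hdn (enum hup hdn (i + 1))).2 z ⟨h2, hz⟩
    omega

/-- EXISTENCE OF FLIP ENUMERATIONS: if the flips of `A` are unbounded above and below, they are enumerated by a
strictly increasing `ℤ → ℤ` (normalised so that `pos 0` is the greatest flip `≤ 0`).  Under i.i.d. fair bits the
hypotheses hold a.s. [folklore] -/
noncomputable def ofUnbounded : FlipEnum A where
  pos := enum hup hdn
  strictMono := strictMono_int_of_lt_succ (enum_lt_succ hup hdn)
  isFlip_iff k := by
    constructor
    · intro hk
      obtain ⟨i, h1, h2⟩ := exists_floor_of_strictMono _ (strictMono_int_of_lt_succ (enum_lt_succ hup hdn)) k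
      rcases h1.lt_or_eq with h1 | h1
      · exact absurd hk (not_isFlip_between hup hdn i h1 h2)
      · exact ⟨i, h1⟩
    · rintro ⟨i, rfl⟩; exact isFlip_enum hup hdn i

/-- The normalisation of `ofUnbounded`: `pos 0 ≤ 0 < pos 1`. [folklore] -/
theorem ofUnbounded_pos_zero_le : (ofUnbounded hup hdn).pos 0 ≤ 0 ∧ 0 < (ofUnbounded hup hdn).pos 1 := by
  have h0 : (ofUnbounded hup hdn).pos 0 = prev hdn 1 := by simp [ofUnbounded, enum, fwd]
  have h1 : (ofUnbounded hup hdn).pos 1 = next hup (prev hdn 1) := by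
    show enum hup hdn (0 + 1) = _; rw [enum_succ hup hdn le_rfl]; simp [enum, fwd]
  refine ⟨by rw [h0]; have := (prev_spec hdn 1).1.1; omega, ?_⟩
  rw [h1]
  by_contra hle
  push Not at hle
  -- `next (prev 1)` is a flip `≤ 0 < 1`, above `prev 1`: contradicts maximality of `prev 1`
  have hn := next_spec hup (prev hdn 1)
  have := (prev_spec hdn 1).2 _ ⟨by omega, hn.1.2⟩
  omega

end Construction

end FlipEnum

namespace FlipEnum

variable {A : Set ℤ} (e : FlipEnum A)

/-- The run index is monotone in the cell. [folklore] -/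
theorem runIdx_mono : Monotone e.runIdx := fun _ _ hkl =>
  csSup_le_csSup (e.bddAbove_le _) (e.nonempty_le _) fun _ (hi : e.pos _ ≤ _) => le_trans hi hkl

/-- The last cell of run `i` has run index `i`. [folklore] -/
theorem runIdx_pos_add_one_sub_one (i : ℤ) : e.runIdx (e.pos (i + 1) - 1) = i :=
  e.runIdx_eq_iff.2 ⟨by have := e.strictMono (lt_add_one i); omega, by omega⟩

/-- Cells of the same run carry the same bit. [folklore] -/
theorem mem_iff_mem_of_runIdx_eq {k l : ℤ} (h : e.runIdx k = e.runIdx l) : (k ∈ A ↔ l ∈ A) := by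
  rw [e.mem_iff_pos_runIdx_mem k, e.mem_iff_pos_runIdx_mem l, h]

/-- The bit flips right after the last cell of a run. [folklore] -/
theorem not_iff_runEnd (i : ℤ) : ¬ (e.pos (i + 1) - 1 ∈ A ↔ e.pos (i + 1) - 1 + 1 ∈ A) := by
  have hf : IsFlip A (e.pos (i + 1)) := (e.isFlip_iff _).2 ⟨i + 1, rfl⟩
  rwa [sub_add_cancel]

/-- A cell after which the bit flips is the last cell of its run. [folklore] -/
theorem eq_runEnd_of_not_iff {k : ℤ} (h : ¬ (k ∈ A ↔ k + 1 ∈ A)) : k = e.pos (e.runIdx k + 1) - 1 := by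
  have := (e.runIdx_add_one_of_not_iff h).2; omega

end FlipEnum

end Freeze

end Summit.CriticalPhenomena.CardyFormulaZ2.Theorems.CornerLineDescent.SymmetricSeed
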